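import Summits.RiemannHypothesis.RiemannHypothesis.Theorems.TiltedLandingLaw421R3RateLightIsolatedChild

/-!
# K-2 budget algebra — the exact identities behind `GeometricBudget` (C1 g35, W-08 ⟨33346⟩; D4b groundwork, memo `D4b-FIRST-ORDER-MEMO` §1/§3(i))

Pure algebra over `ℂ` read as `ℝ²` — no frame, no `f`, no analysis.  With `t_w := −Im w·Im K_w` (the disc's dimensionless DROP PARAMETER) and the
currency `κ = ‖K_v + i/(2·Im v)‖` (`stateKappa` unfolded):
* §1 (I1) the Newton centre's height and the exact per-disc energy drop `Im w² − Im c_w² = 2t_w/‖K_w‖² − Im K_w²/‖K_w‖⁴` (centre `c_w = w − K_w⁻¹`, tree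
  `RhW08.LightIsolatedChild.im_newtonPoint`), its closed-door form, and `t_w ≤ Im w·‖K_w‖`;
* §2 (I2) the CURRENCY identity `κ² = ‖K‖² + Im K/a + 1/(4a²) = ‖K‖² − (t − 1/4)/a²`;
* §3 (I3) the WEIGHT identity `‖K + D‖² = ‖K‖² + 2(Re K·Re D + Im K·Im D) + ‖D‖²` (for `ω = κ²/‖K_z‖²`, `K_z = K_v + D`);
* §4 the explicit pair-field difference `E_z − E_v` in coordinates: its real part `2Δ/‖z − v‖² + 2Δ/‖z − v̄‖²` (Δ = Re z − Re v) and imaginary part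
  `1/(2 Im v) − 1/(2 Im z) − 2(Im z − Im v)/‖z − v‖²` — REAL at equal heights, IMAGINARY for vertical pairs (the coupling of the memo §2).
STATUS: support identities only; `GeometricBudget 10 (1/2)` is NOT proved here or anywhere yet.  Nothing here bears on the truth of RH; RH is not proved;
K-2 / RUNG-P / C′ / ★A OPEN; 33346 / 33347 OPEN; checked ≠ landed ≠ proved. -/

namespace RhW08.BudgetAlgebra

open Complex
open scoped ComplexConjugate
open RhW08.LightIsolatedChild (im_newtonPoint)

/-! ## §1 (I1) centre height, exact drop, closed doors, `t ≤ λ′` -/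

/-- (I1) the exact per-disc energy drop at the Newton centre `c = w − K⁻¹`, in terms of `Im K` (so `2t/‖K‖² − t²/(Im w²‖K‖⁴)` with `t = −Im w·Im K`). -/
theorem sq_sub_center_sq (w K : ℂ) :
    w.im ^ 2 - (w - K⁻¹).im ^ 2 = 2 * (-(w.im * K.im)) / ‖K‖ ^ 2 - K.im ^ 2 / ‖K‖ ^ 4 := by
  rw [im_newtonPoint]
  ring

/-- Closed-door square bound: `|x − c| ≤ δ ⇒ x² ≤ c² + 2|c|δ + δ²`. -/
theorem sq_le_of_abs_sub_le {x c δ : ℝ} (h : |x - c| ≤ δ) : x ^ 2 ≤ c ^ 2 + 2 * |c| * δ + δ ^ 2 := by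
  have hδ : 0 ≤ δ := (abs_nonneg _).trans h
  have h1 : |x| ≤ |c| + δ := by
    have := abs_add_le (x - c) c
    rw [sub_add_cancel] at this
    linarith
  have h2 : x ^ 2 = |x| ^ 2 := (sq_abs x).symm
  have h3 : |x| ^ 2 ≤ (|c| + δ) ^ 2 := pow_le_pow_left₀ (abs_nonneg x) h1 2
  have h4 : c ^ 2 = |c| ^ 2 := (sq_abs c).symm
  nlinarith

/-- (I1, closed doors) a point `u` in the CLOSED disc of radius `δ` about the centre `w − K⁻¹` has
`Im w² − Im u² ≥ 2(−Im w·Im K)/‖K‖² − Im K²/‖K‖⁴ − 2|Im(w − K⁻¹)|·δ − δ²` (the `≤`-door form `GeometricBudget` feeds; cf. C4's open-disc version). -/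
theorem energy_drop_closedDisc {u w K : ℂ} {δ : ℝ} (h : ‖u - (w - K⁻¹)‖ ≤ δ) :
    2 * (-(w.im * K.im)) / ‖K‖ ^ 2 - K.im ^ 2 / ‖K‖ ^ 4 - 2 * |(w - K⁻¹).im| * δ - δ ^ 2 ≤ w.im ^ 2 - u.im ^ 2 := by
  have hwin : |u.im - (w - K⁻¹).im| ≤ δ := by
    have := Complex.abs_im_le_norm (u - (w - K⁻¹))
    rw [sub_im] at this
    exact this.trans h
  have hsq := sq_le_of_abs_sub_le hwin
  have hid := sq_sub_center_sq w K
  linarith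

/-- `t ≤ λ′`: the drop parameter never exceeds `Im w·‖K‖` (`|Im K| ≤ ‖K‖`). -/
theorem neg_im_mul_le {w K : ℂ} (hw : 0 ≤ w.im) : -(w.im * K.im) ≤ w.im * ‖K‖ := by
  have h1 : |K.im| ≤ ‖K‖ := Complex.abs_im_le_norm K
  have h2 : -K.im ≤ ‖K‖ := (neg_le_abs K.im).trans h1
  nlinarith

/-! ## §2 (I2) the currency identity -/

/-- The tilt shift `i/(2a)` as a real multiple of `I`. -/
theorem tilt_shift_eq (a : ℝ) : I / (2 * (a : ℂ)) = (((2 * a)⁻¹ : ℝ) : ℂ) * I := by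
  rw [div_eq_mul_inv, mul_comm]
  push_cast
  ring

/-- Real and imaginary parts of the tilted field `K + i/(2a)`. -/
theorem tilt_re_im (K : ℂ) (a : ℝ) : (K + I / (2 * (a : ℂ))).re = K.re ∧ (K + I / (2 * (a : ℂ))).im = K.im + (2 * a)⁻¹ := by
  rw [tilt_shift_eq]
  constructor
  · simp
  · simp

/-- (I2) CURRENCY IDENTITY: `‖K + i/(2a)‖² = ‖K‖² + Im K/a + 1/(4a²)` (`a ≠ 0`). -/
theorem normSq_tilt (K : ℂ) {a : ℝ} (ha : a ≠ 0) :
    ‖K + I / (2 * (a : ℂ))‖ ^ 2 = ‖K‖ ^ 2 + K.im / a + 1 / (4 * a ^ 2) := by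
  obtain ⟨hre, him⟩ := tilt_re_im K a
  rw [← Complex.normSq_eq_norm_sq, ← Complex.normSq_eq_norm_sq, Complex.normSq_apply, Complex.normSq_apply, hre, him]
  field_simp
  ring

/-- (I2, t-form) with `t := −a·Im K`: `‖K + i/(2a)‖² = ‖K‖² − (t − 1/4)/a²`. -/
theorem normSq_tilt_t (K : ℂ) {a : ℝ} (ha : a ≠ 0) :
    ‖K + I / (2 * (a : ℂ))‖ ^ 2 = ‖K‖ ^ 2 - (-(a * K.im) - 1 / 4) / a ^ 2 := by
  rw [normSq_tilt K ha]
  field_simp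
  ring

/-- (I2, consequence) `Im K ≤ 0` (`t ≥ 0`… more precisely `t ≥ 1/4`) makes the currency SMALLER than the field: `‖K + i/(2a)‖² ≤ ‖K‖²` iff
`−a·Im K ≥ 1/4` (for `a > 0`). Stated as the one-sided bound used for `κ²/‖K_v‖² ≤ 1`. -/
theorem normSq_tilt_le (K : ℂ) {a : ℝ} (ha : 0 < a) (ht : 1 / 4 ≤ -(a * K.im)) :
    ‖K + I / (2 * (a : ℂ))‖ ^ 2 ≤ ‖K‖ ^ 2 := by
  rw [normSq_tilt_t K ha.ne']
  have : 0 ≤ (-(a * K.im) - 1 / 4) / a ^ 2 := div_nonneg (by linarith) (sq_nonneg a)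
  linarith

/-! ## §3 (I3) the weight identity -/

/-- (I3) `‖K + D‖² = ‖K‖² + 2(Re K·Re D + Im K·Im D) + ‖D‖²`. -/
theorem normSq_add_expand (K D : ℂ) :
    ‖K + D‖ ^ 2 = ‖K‖ ^ 2 + 2 * (K.re * D.re + K.im * D.im) + ‖D‖ ^ 2 := by
  rw [← Complex.normSq_eq_norm_sq, ← Complex.normSq_eq_norm_sq, ← Complex.normSq_eq_norm_sq, Complex.normSq_apply,
    Complex.normSq_apply, Complex.normSq_apply, add_re, add_im]
  ring

/-- (I3, two-sided) `|‖K + D‖² − ‖K‖²| ≤ 2‖K‖‖D‖ + ‖D‖²`. -/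
theorem abs_normSq_add_sub_le (K D : ℂ) : |‖K + D‖ ^ 2 - ‖K‖ ^ 2| ≤ 2 * ‖K‖ * ‖D‖ + ‖D‖ ^ 2 := by
  have h1 : ‖K + D‖ ≤ ‖K‖ + ‖D‖ := norm_add_le K D
  have h2 : ‖K‖ ≤ ‖K + D‖ + ‖D‖ := by
    have := norm_sub_le (K + D) D
    rwa [add_sub_cancel_right] at this
  have hK := norm_nonneg K
  have hD := norm_nonneg D
  have hKD := norm_nonneg (K + D)
  rw [abs_le]
  constructor
  · nlinarith
  · nlinarith

/-! ## §4 the explicit pair-field difference `E_z − E_v` -/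

/-- The EXPLICIT part of the state field at `w` with partner `p`: `E_w := (w − w̄)⁻¹ + (w − p)⁻¹ + (w − p̄)⁻¹`. -/
noncomputable def pairExplicit (w p : ℂ) : ℂ :=
  (w - conj w)⁻¹ + (w - p)⁻¹ + (w - conj p)⁻¹

/-- `normSq (v − z̄) = normSq (z − v̄)` (the two conjugate-cross vectors are negatives of conjugates of each other). -/
theorem normSq_sub_conj_comm (v z : ℂ) : Complex.normSq (v - conj z) = Complex.normSq (z - conj v) := by
  rw [Complex.normSq_apply, Complex.normSq_apply]
  simp only [sub_re, sub_im, conj_re, conj_im]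
  ring

/-- §4 REAL and IMAGINARY PARTS of `E_z − E_v` in coordinates (`Δ = Re z − Re v`, `N₁ = ‖z − v‖²`, `N₂ = ‖z − v̄‖²`):
`Re = 2Δ/N₁ + 2Δ/N₂` (vanishes for vertical pairs) and `Im = 1/(2 Im v) − 1/(2 Im z) − 2(Im z − Im v)/N₁` (the `N₂`-terms cancel). -/
theorem re_im_pairExplicit_sub {v z : ℂ} (hv : 0 < v.im) (hz : 0 < z.im) (hvz : v ≠ z) :
    (pairExplicit z v - pairExplicit v z).re =
        2 * (z.re - v.re) / Complex.normSq (z - v) + 2 * (z.re - v.re) / Complex.normSq (z - conj v) ∧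
      (pairExplicit z v - pairExplicit v z).im =
        1 / (2 * v.im) - 1 / (2 * z.im) - 2 * (z.im - v.im) / Complex.normSq (z - v) := by
  have hN1 : Complex.normSq (z - v) ≠ 0 := (Complex.normSq_pos.mpr (sub_ne_zero.mpr (Ne.symm hvz))).ne'
  have hN1' : Complex.normSq (v - z) = Complex.normSq (z - v) := by rw [← Complex.normSq_neg, neg_sub]
  have hN2' : Complex.normSq (v - conj z) = Complex.normSq (z - conj v) := normSq_sub_conj_comm v z
  have hN2 : Complex.normSq (z - conj v) ≠ 0 := by
    rw [Complex.normSq_apply]; simp only [sub_re, sub_im, conj_re, conj_im]; nlinarith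
  have hzz : Complex.normSq (z - conj z) = 4 * z.im ^ 2 := by
    rw [Complex.normSq_apply]; simp only [sub_re, sub_im, conj_re, conj_im]; ring
  have hvv : Complex.normSq (v - conj v) = 4 * v.im ^ 2 := by
    rw [Complex.normSq_apply]; simp only [sub_re, sub_im, conj_re, conj_im]; ring
  have hz0 : z.im ≠ 0 := hz.ne'
  have hv0 : v.im ≠ 0 := hv.ne'
  unfold pairExplicit
  constructor
  · simp only [sub_re, add_re, Complex.inv_re, conj_re, hzz, hvv, hN1', hN2']
    field_simp
    ring
  · simp only [sub_im, add_im, Complex.inv_im, conj_im, hzz, hvv, hN1', hN2']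
    field_simp
    ring

end RhW08.BudgetAlgebra
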